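import Literature.AlgebraicGeometry.HodgeTheory.MonomialSupportedHypersurfaceInvariantCycles
import Literature.AlgebraicGeometry.HodgeTheory.MonomialSupportedHypersurfaceMonodromy
import Literature.AlgebraicGeometry.HodgeTheory.PicardLefschetzNodalForms
import Literature.AlgebraicGeometry.Motives.UniversalHypersurfaceBaseChart
import HarnessLib

/-!
# K1-B GEN assembly, part (a): pencil circles of `S_M(ℂ)` moved to the base point
# (route `SignSymmetricPowers`, item stmt-HodgeConjecture-19716; helper for `stub_signMeridianGeneration`)

Helper file (`--supports stmt-HodgeConjecture-19716`).  For `M`-supported degree-`d` forms `f₁, g` and a radius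
`ε > 0` such that `f₁ + c g` is nonsingular for `0 < |c| ≤ ε`, and any base point `t ∈ S_M(ℂ)`:

* `exists_pencilLoop` — there are `s ∈ S_M(ℂ)` with form `f₁ + ε g`, a path `β : t ⇝ s` in `S_M(ℂ)` (path
  connectedness, `pathConnectedSpace_complexPoints_baseM`) and a loop `ω` at `s` which, pushed to `U(ℂ)`, is the pencil
  circle `θ ↦ f₁ + ε e^{2πiθ} g` (`IsPencilCircle`; `exists_path_pointForm_eq_add_smul` + `exists_path_lift_toBase`).
These are the data `sᵢ, βᵢ, ωᵢ` of the GEN stub.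

Sorry-free; axioms standard; no definition, no named fact.

## References

* [VoisinHodgeII2003] C. Voisin, Hodge Theory and Complex Algebraic Geometry II (CUP 2003), §2.3.1, §3.2.1, §6.2.1.
-/

noncomputable section

set_option linter.dupNamespace false

open MvPolynomial unitInterval
open Literature.AlgebraicGeometry.Motives Literature.AlgebraicGeometry.Motives.UniversalHypersurface
open Literature.AlgebraicGeometry.HodgeTheory Literature.AlgebraicGeometry.HodgeTheory.UniversalHypersurface

namespace Summit.HodgeConjecture.HodgeConjecture.Theorems.SignSymmetricPowersGenLoops

variable (n d : ℕ) (M : Set (DegIndex n d))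

/-- `f + c • g` is `M`-supported if `f` and `g` are. [cite: VoisinHodgeII2003, §6.2.1] -/
theorem isSupportedOn_add_smul {f g : MvPolynomial (Fin (n + 2)) ℂ} (hf : IsSupportedOn n d M f)
    (hg : IsSupportedOn n d M g) (c : ℂ) : IsSupportedOn n d M (f + c • g) := by
  intro m hm
  rw [coeff_add, coeff_smul, hf m hm, hg m hm, smul_zero, add_zero]

/-- **Pencil circles of `S_M(ℂ)`, moved to the base point.**  See the module docstring.
[cite: VoisinHodgeII2003, §3.2.1 (the loop around a critical value) and §6.2.1] -/
theorem exists_pencilLoop {f₁ g : MvPolynomial (Fin (n + 2)) ℂ} (hf₁ : f₁.IsHomogeneous d) (hg : g.IsHomogeneous d)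
    (hM₁ : IsSupportedOn n d M f₁) (hMg : IsSupportedOn n d M g) {ε : ℝ} (hε : 0 < ε)
    (hns : ∀ c : ℂ, c ≠ 0 → ‖c‖ ≤ ε → SmoothHypersurface.IsNonsingularForm ℂ (f₁ + c • g))
    (t : ComplexPoints (baseM ℂ n d M)) :
    ∃ (s : ComplexPoints (baseM ℂ n d M)) (_ : Path t s) (ω : Path s s),
      pointFormM ℂ n d M s = f₁ + ((ε : ℝ) : ℂ) • g ∧
      IsPencilCircle n d f₁ g ε (ω.map (AlgPoints.mapContinuous (toBase ℂ n d M)).continuous) := by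
  -- the circle parameter
  let c : unitInterval → ℂ := fun θ => (ε : ℂ) * Complex.exp (2 * Real.pi * Complex.I * ((θ : ℝ) : ℂ))
  have hc : Continuous c := by
    refine continuous_const.mul (Complex.continuous_exp.comp ?_)
    exact continuous_const.mul (Complex.continuous_ofReal.comp continuous_subtype_val)
  have hcnorm : ∀ θ, ‖c θ‖ = ε := fun θ => by
    have : (2 * Real.pi * Complex.I * ((θ : ℝ) : ℂ)) = ((2 * Real.pi * (θ : ℝ) : ℝ) : ℂ) * Complex.I := by
      push_cast; ring
    rw [norm_mul, this, Complex.norm_exp_ofReal_mul_I, mul_one, Complex.norm_real, Real.norm_eq_abs,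
      abs_of_pos hε]
  have hcne : ∀ θ, c θ ≠ 0 := fun θ => by
    intro h0; have := hcnorm θ; rw [h0, norm_zero] at this; exact hε.ne' this.symm |>.elim
  have hc0 : c 0 = (ε : ℂ) := by simp [c]
  have hc01 : c 0 = c 1 := by
    simp only [c, Set.Icc.coe_zero, Set.Icc.coe_one, Complex.ofReal_zero, Complex.ofReal_one, mul_zero, mul_one,
      Complex.exp_zero, Complex.exp_two_pi_mul_I]
  have hJ : ∀ θ, SmoothHypersurface.IsNonsingularForm ℂ (f₁ + c θ • g) := fun θ =>
    hns (c θ) (hcne θ) (le_of_eq (hcnorm θ))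
  -- the point `s` of `f₁ + ε g`
  have hJε : SmoothHypersurface.IsNonsingularForm ℂ (f₁ + ((ε : ℝ) : ℂ) • g) := by rw [← hc0]; exact hJ 0
  let s : ComplexPoints (baseM ℂ n d M) :=
    pointOfFormM ℂ n d M (isHomogeneous_add_smul hf₁ hg _) hJε (isSupportedOn_add_smul n d M hM₁ hMg _)
  have hs : pointFormM ℂ n d M s = f₁ + ((ε : ℝ) : ℂ) • g := pointFormM_pointOfFormM ℂ n d M _ _ _
  -- the circle in `U(ℂ)` and its lift to `S_M(ℂ)`
  obtain ⟨γ, hγ⟩ := exists_path_pointForm_eq_add_smul n d hf₁ hg hc hc01 hJ (AlgPoints.map (toBase ℂ n d M) s)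
    (by rw [hc0]; exact hs)
  obtain ⟨ω, hω⟩ := exists_path_lift_toBase ℂ n d M γ (fun u => by
    rw [hγ u]; exact isSupportedOn_add_smul n d M hM₁ hMg _)
  -- a path from the base point (path connectedness of `S_M(ℂ)`)
  haveI := pathConnectedSpace_complexPoints_baseM n d M t
  refine ⟨s, PathConnectedSpace.somePath t s, ω, hs, fun θ => ?_⟩
  show pointForm ℂ n d ((ω.map (AlgPoints.mapContinuous (toBase ℂ n d M)).continuous) θ) = _
  rw [Path.map_coe, Function.comp_apply, AlgPoints.mapContinuous_apply, hω θ, hγ θ]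

end Summit.HodgeConjecture.HodgeConjecture.Theorems.SignSymmetricPowersGenLoops

end
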